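import Literature.AlgebraicGeometry.Smoothening.NeronDefect
import Mathlib.RingTheory.Localization.Away.Basic
import Mathlib.RingTheory.Ideal.Quotient.Operations
import Mathlib.Algebra.MvPolynomial.PDeriv
import Mathlib.RingTheory.MvPolynomial.Basic
import HarnessLib

/-!
# The open chart `X ∩ D(h)` as a closed subscheme of affine space (the "affine forest", BLR 3.4)

Topic: `Literature/AlgebraicGeometry/Smoothening` (Bosch–Lütkebohmert–Raynaud, *Néron Models*,
§3.4: the smoothening process is a finite sequence of dilatations of open parts of the centre;
here the bookkeeping that keeps every chart affine *and presented as a quotient of a polynomial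
ring*, so that the local computation `DefectDropPointwise` applies verbatim). For
`X = Spec B/I`, `B = R[T₁, …, T_N]`, and `h ∈ B`, the open subscheme `X ∩ D(h) = Spec (B/I)_h̄` is
the closed subscheme of `𝔸^{N+1}_R = Spec R[T₁, …, T_N, U]` cut out by the kernel of

  `chartMap : R[T, U] → (B/I)_h̄`,  `Tᵢ ↦ tᵢ`, `U ↦ 1/h̄`   (`chartMap_rename`, `chartMap_X_last`),

which is surjective (`chartMap_surjective`); `chartIdeal = ker`, and
`R[T, U]/chartIdeal ≅ (B/I)_h̄` (`chartEquiv`) is a localisation of `B/I` away from `h̄`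
(`isLocalization_away_chart`), so Néron's measure of a point is unchanged in the chart
(`neronDefect_chart_eq`). Finally the containment used for the centre of the next dilatation:
an ideal `𝔠 ⊆ R[T, U]` containing `hU - 1` and `h·x` for all `x ∈ I` contains `chartIdeal`
(`chartIdeal_le`, universal property of the localisation). [folklore]; no named facts (D-0026).

## References

* S. Bosch, W. Lütkebohmert, M. Raynaud, *Néron Models*, Springer 1990, §3.4 (proof of Thm. 2).
  [BLRNeronModels1990] (Not held; number only.)
-/

noncomputable section

open MvPolynomial

namespace Literature.AlgebraicGeometry.Smoothening

universe u

variable {R : Type u} [CommRing R] {N : ℕ} (I : Ideal (MvPolynomial (Fin N) R))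
  (h : MvPolynomial (Fin N) R)

/-- The values of the variables in the chart: `Tᵢ ↦ tᵢ = Tᵢ mod I`, `U ↦ 1/h̄`. [folklore] -/
def chartVal : Fin (N + 1) → Localization.Away (Ideal.Quotient.mk I h) :=
  Fin.lastCases (IsLocalization.Away.invSelf (Ideal.Quotient.mk I h))
    fun i => algebraMap (MvPolynomial (Fin N) R ⧸ I) _ (Ideal.Quotient.mk I (X i))

/-- **The chart map** `R[T₁, …, T_N, U] → (B/I)_h̄`, `Tᵢ ↦ tᵢ`, `U ↦ 1/h̄`. [folklore] -/
def chartMap : MvPolynomial (Fin (N + 1)) R →ₐ[R] Localization.Away (Ideal.Quotient.mk I h) :=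
  aeval (chartVal I h)

/-- `Tᵢ ↦ tᵢ`. [folklore] -/
@[simp]
theorem chartMap_X_castSucc (i : Fin N) :
    chartMap I h (X (Fin.castSucc i)) =
      algebraMap (MvPolynomial (Fin N) R ⧸ I) _ (Ideal.Quotient.mk I (X i)) := by
  simp [chartMap, chartVal]

/-- `U ↦ 1/h̄`. [folklore] -/
@[simp]
theorem chartMap_X_last :
    chartMap I h (X (Fin.last N)) = IsLocalization.Away.invSelf (Ideal.Quotient.mk I h) := by
  simp [chartMap, chartVal]

/-- On polynomials in `T` alone the chart map is `B → B/I → (B/I)_h̄`. [folklore] -/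
theorem chartMap_rename (p : MvPolynomial (Fin N) R) :
    chartMap I h (rename Fin.castSucc p) =
      algebraMap (MvPolynomial (Fin N) R ⧸ I) _ (Ideal.Quotient.mk I p) := by
  let ψ : MvPolynomial (Fin N) R →ₐ[R] Localization.Away (Ideal.Quotient.mk I h) :=
    (IsScalarTower.toAlgHom R (MvPolynomial (Fin N) R ⧸ I) _).comp (Ideal.Quotient.mkₐ R I)
  have hψ : ψ = aeval (chartVal I h ∘ Fin.castSucc) := by
    rw [aeval_unique ψ]
    congr 1
    funext i
    simp [ψ, chartVal]
  change _ = ψ p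
  rw [chartMap, aeval_rename, hψ]

/-- `hU - 1 ↦ 0`. [folklore] -/
theorem chartMap_rel : chartMap I h (rename Fin.castSucc h * X (Fin.last N) - 1) = 0 := by
  rw [map_sub, map_mul, map_one, chartMap_rename, chartMap_X_last, IsLocalization.Away.mul_invSelf,
    sub_self]

/-- **The chart map is surjective**: `a/h̄ᵐ` is the image of `p Uᵐ` for a lift `p` of `a`.
[folklore] -/
theorem chartMap_surjective : Function.Surjective (chartMap I h) := by
  intro z
  obtain ⟨m, a, hz⟩ := IsLocalization.Away.surj (Ideal.Quotient.mk I h) z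
  obtain ⟨p, rfl⟩ := Ideal.Quotient.mk_surjective a
  refine ⟨rename Fin.castSucc p * X (Fin.last N) ^ m, ?_⟩
  rw [map_mul, map_pow, chartMap_rename, chartMap_X_last, ← hz, mul_assoc, ← mul_pow,
    IsLocalization.Away.mul_invSelf, one_pow, mul_one]

/-- **The ideal of the chart**: the kernel of the chart map. [folklore] -/
def chartIdeal : Ideal (MvPolynomial (Fin (N + 1)) R) := RingHom.ker (chartMap I h)

/-- `R[T, U]/chartIdeal ≅ (B/I)_h̄`. [folklore] -/
def chartEquiv : (MvPolynomial (Fin (N + 1)) R ⧸ chartIdeal I h) ≃ₐ[R]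
    Localization.Away (Ideal.Quotient.mk I h) :=
  Ideal.quotientKerAlgEquivOfSurjective (chartMap_surjective I h)

/-- The chart isomorphism on classes. [folklore] -/
@[simp]
theorem chartEquiv_mk (x : MvPolynomial (Fin (N + 1)) R) :
    chartEquiv I h (Ideal.Quotient.mk _ x) = chartMap I h x := rfl

/-- The chart as a `B/I`-algebra: `B/I → (B/I)_h̄ ≅ R[T, U]/chartIdeal`. [folklore] -/
instance algebraChart : Algebra (MvPolynomial (Fin N) R ⧸ I)
    (MvPolynomial (Fin (N + 1)) R ⧸ chartIdeal I h) :=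
  (((chartEquiv I h).symm : Localization.Away (Ideal.Quotient.mk I h) →+*
      MvPolynomial (Fin (N + 1)) R ⧸ chartIdeal I h).comp
    (algebraMap (MvPolynomial (Fin N) R ⧸ I) (Localization.Away (Ideal.Quotient.mk I h)))).toAlgebra

/-- The structure map `B/I → R[T, U]/chartIdeal`, unfolded. [folklore] -/
theorem algebraMap_chart_apply (a : MvPolynomial (Fin N) R ⧸ I) :
    algebraMap (MvPolynomial (Fin N) R ⧸ I) (MvPolynomial (Fin (N + 1)) R ⧸ chartIdeal I h) a =
      (chartEquiv I h).symm (algebraMap _ (Localization.Away (Ideal.Quotient.mk I h)) a) := rfl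

/-- On classes of polynomials: `t̄ᵢ ↦ Tᵢ mod chartIdeal`. [folklore] -/
theorem algebraMap_chart_mk (p : MvPolynomial (Fin N) R) :
    algebraMap (MvPolynomial (Fin N) R ⧸ I) (MvPolynomial (Fin (N + 1)) R ⧸ chartIdeal I h)
        (Ideal.Quotient.mk I p) = Ideal.Quotient.mk _ (rename Fin.castSucc p) := by
  rw [algebraMap_chart_apply, ← chartMap_rename, ← chartEquiv_mk, AlgEquiv.symm_apply_apply]

/-- The chart is an `R`-`B/I`-tower. [folklore] -/
instance isScalarTower_chart : IsScalarTower R (MvPolynomial (Fin N) R ⧸ I)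
    (MvPolynomial (Fin (N + 1)) R ⧸ chartIdeal I h) :=
  IsScalarTower.of_algebraMap_eq (R := R) (S := MvPolynomial (Fin N) R ⧸ I)
    (A := MvPolynomial (Fin (N + 1)) R ⧸ chartIdeal I h) fun r => by
    rw [algebraMap_chart_apply, ← IsScalarTower.algebraMap_apply R (MvPolynomial (Fin N) R ⧸ I)
      (Localization.Away (Ideal.Quotient.mk I h)) r]
    exact ((chartEquiv I h).symm.commutes r).symm

/-- The chart isomorphism is `B/I`-linear. [folklore] -/
def chartEquiv' : Localization.Away (Ideal.Quotient.mk I h) ≃ₐ[MvPolynomial (Fin N) R ⧸ I]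
    MvPolynomial (Fin (N + 1)) R ⧸ chartIdeal I h :=
  AlgEquiv.ofRingEquiv (f := (chartEquiv I h).symm.toRingEquiv) fun _ => rfl

/-- **The chart is a localisation of `B/I` away from `h̄`.** [folklore] -/
instance isLocalization_away_chart :
    IsLocalization.Away (Ideal.Quotient.mk I h) (MvPolynomial (Fin (N + 1)) R ⧸ chartIdeal I h) :=
  IsLocalization.isLocalization_of_algEquiv (Submonoid.powers (Ideal.Quotient.mk I h)) (chartEquiv' I h)

/-- **Néron's measure is unchanged in the chart**: for a point of `X = Spec B/I` with values in
`R'` factoring through the chart (`h̄` a unit in `R'`), `δ` computed on the chart equals `δ`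
computed on `X`. [folklore] -/
theorem neronDefect_chart_eq (R' : Type u) [CommRing R'] [Algebra (MvPolynomial (Fin N) R ⧸ I) R']
    [Algebra (MvPolynomial (Fin (N + 1)) R ⧸ chartIdeal I h) R']
    [IsScalarTower (MvPolynomial (Fin N) R ⧸ I) (MvPolynomial (Fin (N + 1)) R ⧸ chartIdeal I h) R'] :
    neronDefect R (MvPolynomial (Fin (N + 1)) R ⧸ chartIdeal I h) R' =
      neronDefect R (MvPolynomial (Fin N) R ⧸ I) R' :=
  (neronDefect_eq_of_isLocalization R (MvPolynomial (Fin N) R ⧸ I) _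
    (Submonoid.powers (Ideal.Quotient.mk I h)) R').symm

/-- **The centre contains the chart ideal** (universal property of the localisation): an ideal
`𝔠 ⊆ R[T, U]` containing `hU - 1` and `h·x` for every `x ∈ I` contains `chartIdeal`. In the
smoothening process `𝔠 = (ϖ, g₁, …, g_r, hU - 1)` with `h I ⊆ (ϖ, g)`. [folklore] -/
theorem chartIdeal_le (𝔠 : Ideal (MvPolynomial (Fin (N + 1)) R))
    (hU : rename Fin.castSucc h * X (Fin.last N) - 1 ∈ 𝔠)
    (hI : ∀ x ∈ I, rename Fin.castSucc (h * x) ∈ 𝔠) : chartIdeal I h ≤ 𝔠 := by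
  -- `h` is a unit modulo `𝔠`
  have hunit : IsUnit (Ideal.Quotient.mk 𝔠 (rename Fin.castSucc h)) := by
    refine IsUnit.of_mul_eq_one (Ideal.Quotient.mk 𝔠 (X (Fin.last N))) ?_
    rw [← map_mul, ← sub_eq_zero, ← map_one (Ideal.Quotient.mk 𝔠), ← map_sub]
    exact Ideal.Quotient.eq_zero_iff_mem.mpr hU
  -- `B/I → R[T,U]/𝔠`
  have hkill : ∀ x ∈ I, (Ideal.Quotient.mkₐ R 𝔠).comp (rename Fin.castSucc) x = 0 := by
    intro x hx
    have h1 : Ideal.Quotient.mk 𝔠 (rename Fin.castSucc h) *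
        Ideal.Quotient.mk 𝔠 (rename Fin.castSucc x) = 0 := by
      rw [← map_mul, ← map_mul]
      exact Ideal.Quotient.eq_zero_iff_mem.mpr (hI x hx)
    exact (hunit.mul_right_eq_zero).mp h1
  let χ : MvPolynomial (Fin N) R ⧸ I →ₐ[R] MvPolynomial (Fin (N + 1)) R ⧸ 𝔠 :=
    Ideal.Quotient.liftₐ I ((Ideal.Quotient.mkₐ R 𝔠).comp (rename Fin.castSucc)) hkill
  have hχ : ∀ p, χ (Ideal.Quotient.mk I p) = Ideal.Quotient.mk 𝔠 (rename Fin.castSucc p) :=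
    fun p => rfl
  have hχunit : IsUnit (χ (Ideal.Quotient.mk I h)) := by rw [hχ]; exact hunit
  -- `(B/I)_h̄ → R[T,U]/𝔠`
  let ψ : Localization.Away (Ideal.Quotient.mk I h) →+* MvPolynomial (Fin (N + 1)) R ⧸ 𝔠 :=
    IsLocalization.Away.lift (Ideal.Quotient.mk I h) (g := (χ : _ →+* _)) hχunit
  have hψ : ∀ a, ψ (algebraMap _ (Localization.Away (Ideal.Quotient.mk I h)) a) = χ a :=
    fun a => IsLocalization.Away.lift_eq (Ideal.Quotient.mk I h) hχunit a
  -- `ψ (1/h̄) = U mod 𝔠`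
  have hψU : ψ (IsLocalization.Away.invSelf (Ideal.Quotient.mk I h)) =
      Ideal.Quotient.mk 𝔠 (X (Fin.last N)) := by
    have e1 : Ideal.Quotient.mk 𝔠 (rename Fin.castSucc h) *
        ψ (IsLocalization.Away.invSelf (Ideal.Quotient.mk I h)) = 1 := by
      rw [← hχ, ← hψ, ← map_mul, IsLocalization.Away.mul_invSelf, map_one]
    have e2 : Ideal.Quotient.mk 𝔠 (rename Fin.castSucc h) * Ideal.Quotient.mk 𝔠 (X (Fin.last N)) = 1 := by
      rw [← map_mul, ← sub_eq_zero, ← map_one (Ideal.Quotient.mk 𝔠), ← map_sub]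
      exact Ideal.Quotient.eq_zero_iff_mem.mpr hU
    exact hunit.mul_left_cancel (e1.trans e2.symm)
  -- `ψ ∘ chartMap = mk 𝔠`
  have hcomp : ψ.comp (chartMap I h : MvPolynomial (Fin (N + 1)) R →+* _) = Ideal.Quotient.mk 𝔠 := by
    refine MvPolynomial.ringHom_ext (fun r => ?_) (fun i => ?_)
    · rw [RingHom.comp_apply, RingHom.coe_coe, ← MvPolynomial.algebraMap_eq, AlgHom.commutes,
        IsScalarTower.algebraMap_apply R (MvPolynomial (Fin N) R ⧸ I)
          (Localization.Away (Ideal.Quotient.mk I h)), hψ, AlgHom.commutes]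
      rfl
    · rw [RingHom.comp_apply, RingHom.coe_coe]
      refine Fin.lastCases ?_ (fun i => ?_) i
      · rw [chartMap_X_last, hψU]
      · rw [chartMap_X_castSucc, hψ, hχ, rename_X]
  intro x hx
  have : Ideal.Quotient.mk 𝔠 x = 0 := by
    rw [← hcomp, RingHom.comp_apply]
    change ψ (chartMap I h x) = 0
    rw [(RingHom.mem_ker).mp hx, map_zero]
  exact Ideal.Quotient.eq_zero_iff_mem.mp this

end Literature.AlgebraicGeometry.Smoothening

end
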